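import Summits.HodgeConjecture.HodgeConjecture.Theorems.GenericDivisibilityGenericDivisibilityBoundedLevelCleanFunnel
import HarnessLib

/-!
# Route GenericDivisibility — crux C2 `GenericDivisibilityBounded` (stmt-HodgeConjecture-18467):
# the `ℓ`-adic funnel "ONE clean level at `X` ⟹ C2 at `X`" RELATIVE to a bootstrap-stable
# predicate on classes

Line `finite-level-bootstrap`, registered sub-goal `stub_cruxAtOfLevelCleanOn` (lead c5, wave 2).
Sorry-free, definition-free. `X` is smooth projective over `ℂ`, `H = H^k(X(ℂ); ℤ)`,
`z| = z|_{(X∖Z)(ℂ)}` the restriction to the complex points of a Zariski open, and (spelled out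
inline, no definitions, exactly as in the funnel file `…LevelCleanFunnel`):

* "`x` is GENERICALLY TORSION" (`x ∈ GT`): `∃ Z` closed `≠ univ`, `∃ N ≥ 1`, `N • x| = 0`;
* "`D'(m, z)`": `∃ Z` closed `≠ univ`, `∃ y`, `∃ M ≥ 1`, `M • (z| - m • y) = 0`;
* "level `ℓ^s` is CLEAN ON `P`": `∀ z, P z → D'(ℓ^s, z) → ∃ w, z - ℓ • w ∈ GT`.

Here `P` is any predicate on `H` that is STABLE UNDER THE BOOTSTRAP STEP:
`P z`, `z - ℓ^{j+1} • w ∈ GT ⟹ P w`. The lead uses `P` = "Hodge modulo coniveau one".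

## Main results

* `genericDivisibilityBounded_bootstrapOn` — the relative bootstrap: a level clean on `P`
  propagates up the `ℓ`-adic tower on `P`, `P z → D'(ℓ^{n+s}, z) ⇒ ∃ w, z - ℓ^{n+1} • w ∈ GT`
  (the proof of `genericDivisibilityBounded_bootstrap` with `P` threaded through: the induction
  hypothesis is applied to the SAME `z`, and the new class `w₁` satisfies `P` by stability).
* `genericDivisibilityBounded_at_of_levelCleanOn` — **C2 at `X` in degree `k` on `P` from ONE
  level clean on `P`** (relative bootstrap, Krull on the finitely generated `H/GT`, `GT ⊗ ℂ ⊆ N¹`).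
* `stub_cruxAtOfLevelCleanOn` — the registered signature, verbatim.

References: [ColliotTheleneVoisin2012] §3.1, §4.1; [HatcherAT2002] §3.1; [VoisinHodgeI2002] §11.3.
-/

-- `Summit.HodgeConjecture.HodgeConjecture.Theorems` is the mandated namespace (single-problem
-- summit: Problem = Summit), which `linter.dupNamespace` flags on every declaration; the lakefile
-- turns the linter off tree-wide (weak option), restated here so stand-alone elaboration is
-- warning-free too.
set_option linter.dupNamespace false

noncomputable section

namespace Summit.HodgeConjecture.HodgeConjecture.Theorems

open CategoryTheory AlgebraicGeometry
open Literature.AlgebraicGeometry.Motives Literature.AlgebraicGeometry.HodgeTheory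
  Literature.AlgebraicTopology.SingularHomology

/-- Restriction `H^k(X(ℂ);ℤ) → H^k((X∖Z)(ℂ);ℤ)`, the very term of the route decls (notation only). -/
local notation3 (prettyPrint := false) "Res[" X ", " Z ", " k "]" =>
  singularCohomology.map ℤ ℤ
    (⟨Subtype.val, continuous_subtype_val⟩ : C(complexPointsCompl X Z, ComplexPoints X)) k

/-- The inclusion `(X ∖ Z')(ℂ) ↪ (X ∖ Z)(ℂ)` for `h : Z ⊆ Z'`, spelled as in
`genericDivisibility_restrict_restrict` (notation only). -/
local notation3 (prettyPrint := false) "Incl[" X ", " Z ", " Z' ", " h "]" =>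
  (⟨fun P : complexPointsCompl X Z' => (⟨P.1, fun hP : P.1.pt ∈ Z => P.2 (h hP)⟩ :
      complexPointsCompl X Z),
    continuous_subtype_val.subtype_mk fun (P : complexPointsCompl X Z') (hP : P.1.pt ∈ Z) =>
      P.2 (h hP)⟩ : C(complexPointsCompl X Z', complexPointsCompl X Z))

/-! ### The relative bootstrap: a level clean on `P` propagates up the `ℓ`-adic tower on `P` -/

/-- **Relative bootstrap (pure algebra, no Bloch–Kato).** Let `P` be a predicate on
`H^k(X(ℂ);ℤ)` stable under the bootstrap step (`P z`, `z - ℓ^{j+1} • w ∈ GT ⟹ P w`). If level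
`ℓ^s` is clean ON `P` (`P z → D'(ℓ^s, z) ⇒ z ∈ ℓ H + GT`) then
`P z → D'(ℓ^{n+s}, z) ⇒ z ∈ ℓ^{n+1} H + GT` for all `n`: induction on `n` generalizing `z` — the
induction hypothesis applied to the same `z` (so `P z` is at hand) gives `w₁` with
`z - ℓ^{n+1} • w₁ ∈ GT`, whence `P w₁` by stability; on the intersection of the two opens
`M N ℓ^{n+1} • (w₁| - ℓ^s y|) = 0`, i.e. `D'(ℓ^s, w₁)`, and cleanness on `P` gives
`w₁ ∈ ℓ H + GT`, whence `z ∈ ℓ^{n+2} H + GT`. The proof of `genericDivisibilityBounded_bootstrap`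
with `P` threaded through. [folklore] -/
theorem genericDivisibilityBounded_bootstrapOn {n₀ : ℕ} {X : SchemeOver ℂ}
    (hX : IsSmoothProjective n₀ X) (k ℓ s : ℕ) (hℓ : 1 ≤ ℓ)
    (P : singularCohomology ℤ ℤ (ComplexPoints X) k → Prop)
    (hP : ∀ (z w : singularCohomology ℤ ℤ (ComplexPoints X) k) (j : ℕ), P z →
      (∃ Z : Set X.left, IsClosed Z ∧ Z ≠ Set.univ ∧ ∃ N : ℕ, 1 ≤ N ∧
        N • Res[X, Z, k] (z - ℓ ^ (j + 1) • w) = 0) → P w)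
    (hclean : ∀ z : singularCohomology ℤ ℤ (ComplexPoints X) k, P z →
      (∃ Z : Set X.left, IsClosed Z ∧ Z ≠ Set.univ ∧
        ∃ (y : singularCohomology ℤ ℤ (complexPointsCompl X Z) k) (M : ℕ), 1 ≤ M ∧
          M • (Res[X, Z, k] z - ℓ ^ s • y) = 0) →
      ∃ w : singularCohomology ℤ ℤ (ComplexPoints X) k, ∃ Z : Set X.left, IsClosed Z ∧
        Z ≠ Set.univ ∧ ∃ N : ℕ, 1 ≤ N ∧ N • Res[X, Z, k] (z - ℓ • w) = 0)
    (n : ℕ) (z : singularCohomology ℤ ℤ (ComplexPoints X) k) (hPz : P z)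
    (hz : ∃ Z : Set X.left, IsClosed Z ∧ Z ≠ Set.univ ∧
      ∃ (y : singularCohomology ℤ ℤ (complexPointsCompl X Z) k) (M : ℕ), 1 ≤ M ∧
        M • (Res[X, Z, k] z - ℓ ^ (n + s) • y) = 0) :
    ∃ w : singularCohomology ℤ ℤ (ComplexPoints X) k, ∃ Z : Set X.left, IsClosed Z ∧
      Z ≠ Set.univ ∧ ∃ N : ℕ, 1 ≤ N ∧ N • Res[X, Z, k] (z - ℓ ^ (n + 1) • w) = 0 := by
  haveI : IsIntegral X.left := IsSmoothProjective.isIntegral_holds hX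
  induction n generalizing z with
  | zero =>
    rw [Nat.zero_add] at hz
    obtain ⟨w, hw⟩ := hclean z hPz hz
    exact ⟨w, by rwa [Nat.zero_add, pow_one]⟩
  | succ n ih =>
    obtain ⟨Z, hZ, hZne, y, M, hM, hMz⟩ := hz
    -- level `n + s` for `z`, with witness `ℓ • y`
    have hz' : ∃ Z : Set X.left, IsClosed Z ∧ Z ≠ Set.univ ∧
        ∃ (y : singularCohomology ℤ ℤ (complexPointsCompl X Z) k) (M : ℕ), 1 ≤ M ∧
          M • (Res[X, Z, k] z - ℓ ^ (n + s) • y) = 0 := by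
      refine ⟨Z, hZ, hZne, ℓ • y, M, hM, ?_⟩
      rw [← mul_smul, ← pow_succ, show n + s + 1 = n + 1 + s by omega]
      exact hMz
    -- the induction hypothesis for the SAME `z` (so `P z` is available), then stability of `P`
    obtain ⟨w₁, Z', hZ', hZ'ne, N, hN, hNw⟩ := ih z hPz hz'
    have hPw₁ : P w₁ := hP z w₁ n hPz ⟨Z', hZ', hZ'ne, N, hN, hNw⟩
    -- transport both relations to the common open `X ∖ (Z ∪ Z')`
    have hA := congrArg (singularCohomology.map ℤ ℤ Incl[X, Z, Z ∪ Z', Set.subset_union_left] k) hMz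
    rw [map_zero, map_nsmul, map_sub, map_nsmul] at hA
    change M • (singularCohomology.map ℤ ℤ _ k (singularCohomology.map ℤ ℤ _ k z) - _) = 0 at hA
    rw [genericDivisibility_restrict_restrict ℤ Set.subset_union_left] at hA
    have hB : N • Res[X, Z ∪ Z', k] (z - ℓ ^ (n + 1) • w₁) = 0 :=
      genericDivisibilityBounded_nsmul_restrict_mono Set.subset_union_right hNw
    rw [map_sub, map_nsmul] at hB
    -- hence `D'(ℓ^s, w₁)` on `X ∖ (Z ∪ Z')` with multiplier `M N ℓ^{n+1}`
    have hw₁ : ∃ Z₀ : Set X.left, IsClosed Z₀ ∧ Z₀ ≠ Set.univ ∧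
        ∃ (y₀ : singularCohomology ℤ ℤ (complexPointsCompl X Z₀) k) (M₀ : ℕ), 1 ≤ M₀ ∧
          M₀ • (Res[X, Z₀, k] w₁ - ℓ ^ s • y₀) = 0 := by
      refine ⟨Z ∪ Z', hZ.union hZ', genericDivisibilityBounded_union_ne_univ hZ hZ' hZne hZ'ne,
        singularCohomology.map ℤ ℤ Incl[X, Z, Z ∪ Z', Set.subset_union_left] k y,
        M * N * ℓ ^ (n + 1),
        Nat.one_le_iff_ne_zero.2 (Nat.mul_ne_zero (Nat.mul_ne_zero (by omega) (by omega))
          (pow_ne_zero _ (by omega))), ?_⟩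
      rw [pow_add] at hA
      have e : (M * N * ℓ ^ (n + 1)) • (Res[X, Z ∪ Z', k] w₁ -
            ℓ ^ s • singularCohomology.map ℤ ℤ Incl[X, Z, Z ∪ Z', Set.subset_union_left] k y) =
          N • (M • (Res[X, Z ∪ Z', k] z - (ℓ ^ (n + 1) * ℓ ^ s) •
            singularCohomology.map ℤ ℤ Incl[X, Z, Z ∪ Z', Set.subset_union_left] k y)) -
          M • (N • (Res[X, Z ∪ Z', k] z - ℓ ^ (n + 1) • Res[X, Z ∪ Z', k] w₁)) := by
        module
      rw [e, hA, hB, smul_zero, smul_zero, sub_zero]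
    obtain ⟨w₂, Z₂, hZ₂, hZ₂ne, N₂, hN₂, hw₂⟩ := hclean w₁ hPw₁ hw₁
    refine ⟨w₂, ?_⟩
    have hsum : z - ℓ ^ (n + 1 + 1) • w₂ = (z - ℓ ^ (n + 1) • w₁) + ℓ ^ (n + 1) • (w₁ - ℓ • w₂) := by
      rw [pow_succ, mul_smul, smul_sub]
      abel
    rw [hsum]
    exact genericDivisibilityBounded_genericallyTorsion_add ⟨Z', hZ', hZ'ne, N, hN, hNw⟩
      (genericDivisibilityBounded_genericallyTorsion_nsmul _ ⟨Z₂, hZ₂, hZ₂ne, N₂, hN₂, hw₂⟩)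

/-! ### C2 at `X` on `P` from one level clean on `P` -/

/-- **C2 at `X` ON `P` from ONE level clean ON `P`.** On a smooth projective `X`, let `P` be a
predicate on `H^k(X(ℂ);ℤ)` stable under the bootstrap step (`P z`, `z - ℓ^{j+1} • w ∈ GT ⟹ P w`),
and suppose some prime `ℓ` has a level `ℓ^s` (`s ≥ 1`) clean on `P` in degree `k`. Then every
`z ∈ H^k(X(ℂ);ℤ)` with `P z` that is divisible by every `m ≥ 1` on the complex points of some
non-empty Zariski open has complexification in `supportedClasses X k 1`: `D'(ℓ^{n+s}, z)` for every
`n`, relative bootstrap `genericDivisibilityBounded_bootstrapOn`, Krull on the finitely generated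
`H/GT` (`genericDivisibilityBounded_genericallyTorsion_of_forall_pow`), and `GT ⊗ ℂ ⊆ N¹`
(`genericDivisibilityBounded_ringChange_mem_supportedClasses`) — the proof of
`genericDivisibilityBounded_at_of_levelClean` on `P`. [folklore] -/
theorem genericDivisibilityBounded_at_of_levelCleanOn {n₀ : ℕ} {X : SchemeOver ℂ}
    (hX : IsSmoothProjective n₀ X) (k : ℕ) {ℓ s : ℕ} (hℓ : ℓ.Prime) (hs : 1 ≤ s)
    (P : singularCohomology ℤ ℤ (ComplexPoints X) k → Prop)
    (hP : ∀ (z w : singularCohomology ℤ ℤ (ComplexPoints X) k) (j : ℕ), P z →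
      (∃ Z : Set X.left, IsClosed Z ∧ Z ≠ Set.univ ∧ ∃ N : ℕ, 1 ≤ N ∧
        N • Res[X, Z, k] (z - ℓ ^ (j + 1) • w) = 0) → P w)
    (hclean : ∀ z : singularCohomology ℤ ℤ (ComplexPoints X) k, P z →
      (∃ Z : Set X.left, IsClosed Z ∧ Z ≠ Set.univ ∧
        ∃ (y : singularCohomology ℤ ℤ (complexPointsCompl X Z) k) (M : ℕ), 1 ≤ M ∧
          M • (Res[X, Z, k] z - ℓ ^ s • y) = 0) →
      ∃ w : singularCohomology ℤ ℤ (ComplexPoints X) k, ∃ Z : Set X.left, IsClosed Z ∧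
        Z ≠ Set.univ ∧ ∃ N : ℕ, 1 ≤ N ∧ N • Res[X, Z, k] (z - ℓ • w) = 0)
    (z : singularCohomology ℤ ℤ (ComplexPoints X) k) (hPz : P z)
    (hz : ∀ m : ℕ, 1 ≤ m → ∃ Z : Set X.left, IsClosed Z ∧ Z ≠ Set.univ ∧
      ∃ y : singularCohomology ℤ ℤ (complexPointsCompl X Z) k, m • y = Res[X, Z, k] z) :
    singularCohomology.ringChange (Int.castRingHom ℂ) (ComplexPoints X) k z ∈
      supportedClasses X k 1 := by
  have _ := hs
  have hall : ∀ n : ℕ, ∃ w : singularCohomology ℤ ℤ (ComplexPoints X) k, ∃ Z : Set X.left,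
      IsClosed Z ∧ Z ≠ Set.univ ∧ ∃ N : ℕ, 1 ≤ N ∧ N • Res[X, Z, k] (z - ℓ ^ (n + 1) • w) = 0 := by
    intro n
    refine genericDivisibilityBounded_bootstrapOn hX k ℓ s hℓ.one_lt.le P hP hclean n z hPz ?_
    obtain ⟨Z, hZ, hZne, y, hy⟩ := hz (ℓ ^ (n + s)) (Nat.one_le_pow _ _ hℓ.pos)
    exact ⟨Z, hZ, hZne, y, 1, le_rfl, by rw [one_smul, ← hy, sub_self]⟩
  exact genericDivisibilityBounded_ringChange_mem_supportedClasses hX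
    (genericDivisibilityBounded_genericallyTorsion_of_forall_pow hX hℓ.two_le hall)

/-! ### The registered sub-goal -/

/-- **Registered sub-goal `stub_cruxAtOfLevelCleanOn` of line `finite-level-bootstrap` (crux C2,
stmt-HodgeConjecture-18467), verbatim:** the funnel "one clean level `ℓ^s` at `X` ⟹ C2 at `X`"
relative to any predicate `P` on `H^k(X(ℂ);ℤ)` stable under the bootstrap step — a level clean on
the classes satisfying `P` gives C2 at `X` on the classes satisfying `P`
(proof: `genericDivisibilityBounded_at_of_levelCleanOn`). [folklore] -/
theorem stub_cruxAtOfLevelCleanOn :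
    ∀ ⦃n₀ : ℕ⦄ ⦃X : SchemeOver ℂ⦄, IsSmoothProjective n₀ X → ∀ (k ℓ s : ℕ), ℓ.Prime → 1 ≤ s →
      ∀ (P : singularCohomology ℤ ℤ (ComplexPoints X) k → Prop),
        (∀ (z w : singularCohomology ℤ ℤ (ComplexPoints X) k) (j : ℕ), P z →
          (∃ Z : Set X.left, IsClosed Z ∧ Z ≠ Set.univ ∧ ∃ N : ℕ, 1 ≤ N ∧
            N • singularCohomology.map ℤ ℤ
              (⟨Subtype.val, continuous_subtype_val⟩ : C(complexPointsCompl X Z, ComplexPoints X))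
              k (z - ℓ ^ (j + 1) • w) = 0) → P w) →
        (∀ z : singularCohomology ℤ ℤ (ComplexPoints X) k, P z →
          (∃ Z : Set X.left, IsClosed Z ∧ Z ≠ Set.univ ∧
            ∃ (y : singularCohomology ℤ ℤ (complexPointsCompl X Z) k) (M : ℕ), 1 ≤ M ∧
              M • (singularCohomology.map ℤ ℤ
                (⟨Subtype.val, continuous_subtype_val⟩ : C(complexPointsCompl X Z, ComplexPoints X))
                k z - ℓ ^ s • y) = 0) →
          ∃ w : singularCohomology ℤ ℤ (ComplexPoints X) k,
            ∃ Z : Set X.left, IsClosed Z ∧ Z ≠ Set.univ ∧ ∃ N : ℕ, 1 ≤ N ∧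
              N • singularCohomology.map ℤ ℤ
                (⟨Subtype.val, continuous_subtype_val⟩ : C(complexPointsCompl X Z, ComplexPoints X))
                k (z - ℓ • w) = 0) →
        ∀ z : singularCohomology ℤ ℤ (ComplexPoints X) k, P z →
          (∀ m : ℕ, 1 ≤ m → ∃ Z : Set X.left, IsClosed Z ∧ Z ≠ Set.univ ∧
            ∃ y : singularCohomology ℤ ℤ (complexPointsCompl X Z) k,
              m • y = singularCohomology.map ℤ ℤ
                (⟨Subtype.val, continuous_subtype_val⟩ : C(complexPointsCompl X Z, ComplexPoints X)) k z) →
          singularCohomology.ringChange (Int.castRingHom ℂ) (ComplexPoints X) k z ∈ supportedClasses X k 1 :=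
  fun _ _ hX k _ _ hℓ hs P hP hclean z hPz hz ↦
    genericDivisibilityBounded_at_of_levelCleanOn hX k hℓ hs P hP hclean z hPz hz

end Summit.HodgeConjecture.HodgeConjecture.Theorems

end
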